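import Mathlib
import HarnessLib
import Summits.ResolutionOfSingularities.ResolutionOfSingularities.Theorems.WildQuotientsWildQuotientResolutionS1aSymChartMemberInv
import Summits.ResolutionOfSingularities.ResolutionOfSingularities.Theorems.WildQuotientsWildQuotientResolutionS1aLinesModel
import Summits.ResolutionOfSingularities.ResolutionOfSingularities.Theorems.WildQuotientsWildQuotientResolutionS1aKillLeafFamily
import Summits.ResolutionOfSingularities.ResolutionOfSingularities.Theorems.WildQuotientsWildQuotientResolutionS1aA1KillsIn

/-!
# S1a — R3 `lines_killsIn_two`: the LINE-ARRANGEMENT TAIL CLASS `L_d` is a TWO-SHOT kill (symmetric root + ONE parallel `d`-component kill)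

[OURS · L1 W4.5c · lead-1 g15; plan-1 RULING R-F15l (2) «R3 := ★★★ `lines_killsIn_two : KillsIn 2 (GModel.initial hq h₀)` for the line-arrangement tail class
`L_d` (every `d ≥ 2`, `ℓᵢ` pairwise non-proportional)»; both member types (weights (2,1) for `ℓᵢ(1,1) ≠ 0`, (1,1) for the σ-invariant line) through ✓`exists_isPrincipalCentre_of_symChartLine`;
lead-1 ANSWER Q-R3 + FINDING (product cover: one component per chart); bricks ✓`…S1aSymTail`, ✓`…S1aLinesCover`, ✓`…S1aLinesModel`, ✓`…S1aSymChartMemberInv`,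
✓`…S1aKillLeafFamily`] — NOT statements of the manuscript; counted 0; AI-level work, weaker than expert review. Crux stmt-ResolutionOfSingularities-17941
`CyclicQuotientFourfolds`, line `s1a-logminvertex` v13 (`stub_reachLowerInFX`).

* `symT_rootChartData` — the symmetric root with a general tail is a legal move on the initial model (explicit root node);
* ★★★ `GameFrame.GModel.lines_killsIn_two` — for the datum σ: x₁ ↦ x₁ + x₀, x₂ ↦ x₂ + x₀, x₃ ↦ x₃ + ∏_{i<d} (aᵢx₁ + bᵢx₂) (`d ≥ 2`, `aᵢbⱼ ≠ aⱼbᵢ`,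
  `X′` affine regular with `Γ(X′,⊤) ≃ k[x₀..x₃]` intertwining `g₀` with `σ`, `char k = p`): `KillsIn 2 (GModel.initial hq h₀)` — MOVE 1 the symmetric root
  (x₀ : d+1, x₁ : 1, x₂ : 1) with the PRODUCT COVER `(x₀^{…}, (∏_{m≠i} N(ℓ_m))^{…})_{i<d}` (`[x₀]` killed; the chart `i+1` holds exactly the component `V(x₀′, ℓᵢ(x′))`);
  MOVE 2 = ONE parallel kill of the `d` DISJOINT components by the line members ✓`exists_isPrincipalCentre_of_symChartLin` ((x₀′ : 2, ℓᵢ : 1; shift 1, β = s^d), unit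
  `∏_{m≠i} ℓ_m(x′)`), separated by the transition sections; uniform in the chart index;
* ★★★ `GameFrame.GModel.exists_reachLowerF_initial_of_lines` — the conclusion of `ReachLowerInF(X)` for every root decoration (class of the research stub).
-/

set_option linter.dupNamespace false

noncomputable section

open CategoryTheory Limits AlgebraicGeometry TopologicalSpace Topology Opposite MvPolynomial
open Literature.AlgebraicGeometry.Resolution Literature.AlgebraicGeometry.RelativeSpec
open scoped LaurentPolynomial
open Summit.ResolutionOfSingularities.ResolutionOfSingularities.Theorems.WildQuotientResolution.S1
open Summit.ResolutionOfSingularities.ResolutionOfSingularities.Theorems.WildQuotientResolution.S1.NodeAtlas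
open Summit.ResolutionOfSingularities.ResolutionOfSingularities.Theorems.WildQuotientResolution.S1.CoarseChart
open Summit.ResolutionOfSingularities.ResolutionOfSingularities.Theorems.WildQuotientResolution.S1.ProducerStep
open Summit.ResolutionOfSingularities.ResolutionOfSingularities.Theorems.WildQuotientResolution.S1.NpFrame
open Summit.ResolutionOfSingularities.ResolutionOfSingularities.Theorems.WildQuotientResolution.S1.GoodCharts
open Summit.ResolutionOfSingularities.ResolutionOfSingularities.Theorems.WildQuotientResolution.S1.BlowupCharts
open Summit.ResolutionOfSingularities.ResolutionOfSingularities.Theorems.WildQuotientResolution.S1.KillableTransport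
open Summit.ResolutionOfSingularities.ResolutionOfSingularities.Theorems.WildQuotientResolution.S1.KillCert
open Summit.ResolutionOfSingularities.ResolutionOfSingularities.Theorems.WildQuotientResolution.S1.ReesBigrading
open Summit.ResolutionOfSingularities.ResolutionOfSingularities.Theorems.WildQuotientResolution.S1.NodeTransport
open Summit.ResolutionOfSingularities.ResolutionOfSingularities.Theorems.WildQuotientResolution.S1.CobordantTransport
open Summit.ResolutionOfSingularities.ResolutionOfSingularities.Theorems.WildQuotientResolution.BlowupExit
open Summit.ResolutionOfSingularities.ResolutionOfSingularities.Theorems.WildQuotientResolution.S1.KillGlue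
open Summit.ResolutionOfSingularities.ResolutionOfSingularities.Theorems.WildQuotientResolution.S1.FreeModel
open Summit.ResolutionOfSingularities.ResolutionOfSingularities.Theorems.WildQuotientResolution.S1.ModelNode

namespace Summit.ResolutionOfSingularities.ResolutionOfSingularities.Theorems.WildQuotientResolution.S1.GameFrame.GModel

variable {p : ℕ} {X' X₁ : Scheme.{0}} {q : X' ⟶ X₁} {G : Type} [Group G] {ρ : G →* Aut X'} {g₀ : G}

/-- ★ **THE SYMMETRIC ROOT WITH A GENERAL TAIL IS A LEGAL MOVE, with the explicit root node** (as ✓`sym_rootChartData`, tail `σx₃ = x₃ + t`, `e⁻¹t ∈ 𝒥_δ`).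
[OURS · L1 W4.5c · R3 symmetric root, scheme level] -/
theorem symT_rootChartData [Finite G] (hp : p.Prime) (hG : ∀ g : G, g ∈ Subgroup.zpowers g₀) (hg₀ : g₀ ^ p = 1)
    (hq : ∀ g : G, (ρ g).hom ≫ q = q) [IsIntegral X'] [IsLocallyNoetherian X'] [X'.IsSeparated]
    (hreg : Scheme.IsRegular X') {k : Type} [Field k] (σ : MvPolynomial (Fin 4) k ≃+* MvPolynomial (Fin 4) k) (hC : ∀ a : k, σ (C a) = C a)
    (h0 : σ (X 0) = X 0) (h1 : σ (X 1) = X 1 + X 0) (h2 : σ (X 2) = X 2 + X 0) (δ : ℕ) (t : MvPolynomial (Fin 4) k) (h3 : σ (X 3) = X 3 + t)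
    (h₀ : NodeAtlas p (⟨ρ, hq⟩ : ActionOver q G) g₀) (O : (GModel.initial (p := p) (g₀ := g₀) hq h₀).act.StableAffineOpens) (hO : IsAffineOpen O.1)
    (e : Γ(X', O.1) ≃+* MvPolynomial (Fin 4) k) (hact : ∀ x : Γ(X', O.1), actOEquiv (GModel.initial hq h₀).act O g₀ x = e.symm (σ (e x)))
    (ht : e.symm t ∈ (weightedFiltration (e.symm ∘ ![X 0, X 1, X 2] : Fin 3 → Γ(X', O.1)) ![δ + 1, 1, 1]).ideal δ)
    (hZcl : IsClosed (X'.zeroLocus (U := O.1) (Set.range (e.symm ∘ ![X 0, X 1, X 2] : Fin 3 → Γ(X', O.1))) ∩ (O.1 : Set (GModel.initial (p := p) (g₀ := g₀) hq h₀).V))) :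
    ∃ (𝒜 : (Π j : Fin 0, ZMod ((![] : Fin 0 → ℕ) j)) → AddSubgroup Γ(X', O.1)) (_ : GradedRing 𝒜) (e' : Γ(X', O.1) ≃+* ↥(𝒜 0))
      (𝒦 : ReesFiltration X') (d : ℕ),
      (∀ i, 𝒜 i = ⊤) ∧ (∀ b, ((e' b : ↥(𝒜 0)) : Γ(X', O.1)) = b) ∧
      IsTameNode p Γ(X', O.1) 𝒜 (actOEquiv (GModel.initial hq h₀).act O g₀) ∧ (∀ x, (⇑(actOEquiv (GModel.initial hq h₀).act O g₀))^[p] x = x) ∧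
      (∀ t : Γ(X', O.1), ((e' (((GModel.initial hq h₀).act.aut g₀⁻¹).hom.appLE O.1 O.1 (O.2.1 g₀⁻¹).ge t) : ↥(𝒜 0)) : Γ(X', O.1)) =
        actOEquiv (GModel.initial hq h₀).act O g₀ ((e' t : ↥(𝒜 0)) : Γ(X', O.1))) ∧
      VeroneseNormalised 𝒜 (e.symm ∘ ![X 0, X 1, X 2]) ![δ + 1, 1, 1] d ∧
      IsAdmissibleCentre p (GModel.initial hq h₀).act g₀ 𝒦 d ∧ IsCentreChart p (GModel.initial hq h₀).act g₀ 𝒦 d O ∧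
      (∀ (g : G) (n : ℕ), (𝒦.ideal n).comap ((GModel.initial hq h₀).act.aut g).hom = 𝒦.ideal n) ∧
      (∀ n, (𝒦.filtration ⟨O.1, hO⟩).ideal n = ((traceFiltration 𝒜 (e.symm ∘ ![X 0, X 1, X 2]) ![δ + 1, 1, 1]).ideal n).comap (e' : Γ(X', O.1) →+* ↥(𝒜 0))) ∧
      (((𝒦.ideal d).support : Set X')) = X'.zeroLocus (U := O.1) (Set.range (e.symm ∘ ![X 0, X 1, X 2] : Fin 3 → Γ(X', O.1))) ∩ (O.1 : Set (GModel.initial (p := p) (g₀ := g₀) hq h₀).V) := by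
  haveI hsep : (GModel.initial (p := p) (g₀ := g₀) hq h₀).V.IsSeparated := ‹X'.IsSeparated›
  have _ := hp.pos
  obtain ⟨𝒜, gr, e', 𝒦, d, h𝒜, he', htame, hσp, hσ, -, hver, hadm, hcentre, hG𝒦, -, h𝒦tr, hsupp⟩ :=
    exists_isAdmissibleCentre_of_chartData (p := p) hG hg₀ (GModel.initial hq h₀) hreg O hO (e.symm ∘ ![X 0, X 1, X 2]) ![δ + 1, 1, 1] (by norm_num)
      (fun i => by fin_cases i <;> simp) (Sym.sym_isRegular e) (Sym.sym_isRegularRing_quotient e)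
      (fun n => Sym.symT_map_le σ hC h0 h1 h2 δ t h3 e (actOEquiv (GModel.initial hq h₀).act O g₀) hact ht n) hZcl
  exact ⟨𝒜, gr, e', 𝒦, d, h𝒜, he', htame, hσp, hσ, hver, hadm, hcentre, hG𝒦, h𝒦tr, hsupp⟩

set_option maxHeartbeats 8000000 in
set_option synthInstance.maxHeartbeats 400000 in
/-- ★★★ **R3: `KillsIn 2` FOR THE INITIAL MODEL OF THE LINE-ARRANGEMENT TAIL CLASS `L_d`**. See the module docstring.
[OURS · L1 W4.5c · R-F15l R3; NOT a statement of the manuscript] -/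
theorem lines_killsIn_two [Finite G] (hp : p.Prime) (hG : ∀ g : G, g ∈ Subgroup.zpowers g₀) (hg₀ : g₀ ^ p = 1)
    (hq : ∀ g : G, (ρ g).hom ≫ q = q) [IsIntegral X'] [IsLocallyNoetherian X'] [X'.IsSeparated] [IsAffine X']
    (hreg : Scheme.IsRegular X') {k' : Type} [Field k'] (φ : X₁ ⟶ Spec (.of k')) [IsSeparated φ] [LocallyOfFiniteType φ] [IsFinite q]
    {k : Type} [Field k] [CharP k p] (σ : MvPolynomial (Fin 4) k ≃+* MvPolynomial (Fin 4) k) (hC : ∀ a : k, σ (C a) = C a)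
    (h0 : σ (X 0) = X 0) (h1 : σ (X 1) = X 1 + X 0) (h2 : σ (X 2) = X 2 + X 0)
    {d : ℕ} (hd : 2 ≤ d) (a b : Fin d → k) (hprop : ∀ i j : Fin d, i ≠ j → a i * b j ≠ a j * b i)
    (h3 : σ (X 3) = X 3 + (∏ m : Fin d, (C (a m) * X 1 + C (b m) * X 2)))
    (e : Γ(X', ⊤) ≃+* MvPolynomial (Fin 4) k)
    (hστ : ∀ t : Γ(X', ⊤), e ((ρ g₀⁻¹).hom.appLE ⊤ ⊤ (by rw [Scheme.Hom.preimage_top]) t) = σ (e t))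
    (h₀ : NodeAtlas p (⟨ρ, hq⟩ : ActionOver q G) g₀) :
    KillsIn 2 (GModel.initial (p := p) (g₀ := g₀) hq h₀) := by
  classical
  haveI : NeZero p := ⟨hp.ne_zero⟩
  have hp1 : p ≠ 1 := hp.one_lt.ne'
  -- the root chart `O = X′`
  haveI : IsAffine (⊤ : X'.Opens) := isAffineOpen_top X'
  have hAff : IsAffineHom ((⊤ : X'.Opens).ι ≫ q) := inferInstance
  have hst : ∀ g : G, (ρ g).hom ⁻¹ᵁ (⊤ : X'.Opens) = ⊤ := fun g => Scheme.Hom.preimage_top _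
  let O : (GModel.initial (p := p) (g₀ := g₀) hq h₀).act.StableAffineOpens := ⟨⊤, hst, hAff⟩
  have hO : IsAffineOpen O.1 := isAffineOpen_top X'
  haveI hsep₀ : (GModel.initial (p := p) (g₀ := g₀) hq h₀).V.IsSeparated := ‹X'.IsSeparated›
  obtain ⟨e₀, he₀⟩ : ∃ e₀ : Γ(X', O.1) ≃+* MvPolynomial (Fin 4) k, ∀ t, e₀ t = e t := ⟨e, fun _ => rfl⟩
  have hact : ∀ t : Γ(X', O.1), actOEquiv (GModel.initial hq h₀).act O g₀ t = e₀.symm (σ (e₀ t)) := fun t => by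
    apply e₀.injective
    rw [e₀.apply_symm_apply, he₀, he₀, ← hστ]
    rfl
  obtain ⟨τ₀, hτ₀⟩ : ∃ τ₀ : Γ(X', O.1) ≃+* Γ(X', O.1), τ₀ = actOEquiv (GModel.initial hq h₀).act O g₀ := ⟨_, rfl⟩
  have hact₀ : ∀ t : Γ(X', O.1), τ₀ t = e₀.symm (σ (e₀ t)) := fun t => by rw [hτ₀]; exact hact t
  -- the symmetric centre `(e⁻¹x₀ : d+1, e⁻¹x₁ : 1, e⁻¹x₂ : 1)`, tail `∏ ℓ_m ∈ 𝒥_d`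
  have ht := KillCert.Lines.lines_tail_mem a b e₀
  have hσJ : ∀ n : ℕ, ((weightedFiltration (e₀.symm ∘ ![X 0, X 1, X 2] : Fin 3 → Γ(X', O.1)) ![d + 1, 1, 1]).ideal n).map (τ₀ : Γ(X', O.1) →+* Γ(X', O.1)) ≤ (weightedFiltration (e₀.symm ∘ ![X 0, X 1, X 2] : Fin 3 → Γ(X', O.1)) ![d + 1, 1, 1]).ideal n :=
    fun n => Sym.symT_map_le σ hC h0 h1 h2 d _ h3 e₀ τ₀ hact₀ ht n
  have hw : ∀ i, 0 < (![d + 1, 1, 1] : Fin 3 → ℕ) i := fun i => by fin_cases i <;> simp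
  have hK1 := Sym.sym_isRegular e₀
  have hK1' := Sym.sym_isRegularRing_quotient e₀
  have hZcl : IsClosed (X'.zeroLocus (U := O.1) (Set.range (e₀.symm ∘ ![X 0, X 1, X 2] : Fin 3 → Γ(X', O.1))) ∩ (O.1 : Set (GModel.initial (p := p) (g₀ := g₀) hq h₀).V)) :=
    (X'.zeroLocus_isClosed _).inter (by exact isClosed_univ)
  obtain ⟨𝒜, gr, e', 𝒦, dv, h𝒜, he', htame, hσp, hσ, hver, hadm, -, hG𝒦, h𝒦tr, -⟩ :=
    symT_rootChartData hp hG hg₀ hq hreg σ hC h0 h1 h2 d _ h3 h₀ O hO e₀ hact ht hZcl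
  letI : GradedRing 𝒜 := gr
  have htame₀ : IsTameNode p Γ(X', O.1) 𝒜 τ₀ := by rw [hτ₀]; exact htame
  have hσp₀ : ∀ x : Γ(X', O.1), (⇑τ₀)^[p] x = x := by rw [hτ₀]; exact hσp
  have hσ₀ : ∀ t : Γ(X', O.1), ((e' (((GModel.initial hq h₀).act.aut g₀⁻¹).hom.appLE O.1 O.1 (O.2.1 g₀⁻¹).ge t) : ↥(𝒜 0)) : Γ(X', O.1)) =
      τ₀ ((e' t : ↥(𝒜 0)) : Γ(X', O.1)) := fun t => by rw [hτ₀]; exact hσ t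
  refine ⟨𝒦, dv, hadm, fun M₁ hm₁ => ⟨⟨NodeAtlasData.ofNodeAtlas (p := p) (ρ := M₁.act) (g₀ := g₀) M₁.atlas⟩, ?_⟩⟩
  obtain ⟨π₁, hbl, -, hrM, hcomm⟩ := hm₁
  haveI : M₁.V.IsSeparated := isSeparated_of_datum φ M₁
  -- ### MOVE 1 on the realisation `M₁`: the `d+1` producer charts and the atlas `𝔄₁`
  haveI hchar : CharP Γ(X', O.1) p := charP_of_injective_ringHom (f := e₀.symm.toRingHom) e₀.symm.injective p
  have hdv : 0 < dv := hver.1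
  have hdp : 0 < dv * (d - 1) * p := Nat.mul_pos (Nat.mul_pos hdv (by omega)) hp.pos
  have hk : 0 < (d - 1) * ((d + 1) * d * p) := Nat.mul_pos (by omega) (Nat.mul_pos (Nat.mul_pos (by omega) (by omega)) hp.pos)
  have hE : 0 < (d + 1) * d * dv := Nat.mul_pos (Nat.mul_pos (by omega) (by omega)) hdv
  have hf : ∀ i, (e₀.symm ∘ ![X 0, X 1, X 2] : Fin 3 → Γ(X', O.1)) i ∈ 𝒜 ((fun _ => (0 : Π j : Fin 0, ZMod ((![] : Fin 0 → ℕ) j))) i) := fun i => by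
    rw [h𝒜]; trivial
  have hC0 : ∀ c : k, e₀.symm (C c) ∈ 𝒜 0 := fun c => by rw [h𝒜]; trivial
  -- the product cover, kept opaque
  -- (the cover is introduced by a definitional equation: an `obtain ⟨cov, h0, hS⟩ : ∃ cov, cov 0 = … ∧ ∀ i, cov i.succ = … := ⟨Fin.cons …, …⟩`
  -- makes `rcases` elaborate the anonymous constructor without the expected type and costs > 16M heartbeats)
  obtain ⟨cov, hcov⟩ : ∃ cov : Fin (d + 1) → Γ(X', O.1), cov = Fin.cons (e₀.symm (X 0) ^ (d * (dv * (d - 1) * p)))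
      (fun i : Fin d => (∏ m ∈ Finset.univ.erase i, ∏ j : ZMod p, (e₀.symm (C (a m) * X 1 + C (b m) * X 2) + (j.val : Γ(X', O.1)) * e₀.symm (C (a m + b m) * X 0))) ^ ((d + 1) * d * dv)) := ⟨_, rfl⟩
  have hcov0 : cov 0 = e₀.symm (X 0) ^ (d * (dv * (d - 1) * p)) := by rw [hcov]; exact Fin.cons_zero _ _
  have hcovS : ∀ i : Fin d, cov i.succ = (∏ m ∈ Finset.univ.erase i, ∏ j : ZMod p, (e₀.symm (C (a m) * X 1 + C (b m) * X 2) + (j.val : Γ(X', O.1)) * e₀.symm (C (a m + b m) * X 0))) ^ ((d + 1) * d * dv) := fun i => by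
    rw [hcov]; exact Fin.cons_succ _ _ i
  obtain ⟨y, hydef⟩ : ∃ y : Fin (d + 1) → ↥(𝒜 0), y = fun j => e' (cov j) := ⟨_, rfl⟩
  have hyval : ∀ j, (y j).1 = cov j := fun j => by rw [hydef]; exact he' (cov j)
  have hdeg : dv * (d - 1) * ((d + 1) * d * p) = dv * ((d - 1) * ((d + 1) * d * p)) := Nat.mul_assoc _ _ _
  have hy : ∀ j, y j ∈ (traceFiltration 𝒜 (e₀.symm ∘ ![X 0, X 1, X 2] : Fin 3 → Γ(X', O.1)) ![d + 1, 1, 1]).ideal (dv * ((d - 1) * ((d + 1) * d * p))) := fun j => by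
    rw [mem_traceFiltration_iff, hyval]
    refine Fin.cases ?_ (fun i => ?_) j
    · rw [hcov0, ← hdeg]; exact Sym.sym_cover_zero_mem d e₀ (p := p) (dv * (d - 1))
    · rw [hcovS i, ← hdeg]; exact KillCert.Lines.lines_cover_P_mem a b e₀ (p := p) dv i
  have hσy : ∀ j, τ₀ (y j).1 = (y j).1 := fun j => by
    rw [hyval]
    refine Fin.cases ?_ (fun i => ?_) j
    · rw [hcov0]; exact Sym.sym_cover_zero_fixed σ h0 e₀ τ₀ hact₀ _
    · rw [hcovS i]; exact KillCert.Lines.lines_cover_P_fixed σ hC h0 h1 h2 a b e₀ τ₀ hact₀ hp1 dv i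
  have hdbarZ : (((dv * ((d - 1) * ((d + 1) * d * p))) : ℕ) : ℤ) = (((d + 1) * d * dv : ℕ) : ℤ) * ((d - 1 : ℕ) : ℤ) * (p : ℤ) := by push_cast; ring
  have hrad : ∀ l : Fin 3, cobordantAlgebra.u' (e₀.symm ∘ ![X 0, X 1, X 2] : Fin 3 → Γ(X', O.1)) ![d + 1, 1, 1] l ∈ (Ideal.span (Set.range fun j => coverElement 𝒜 (e₀.symm ∘ ![X 0, X 1, X 2]) ![d + 1, 1, 1] (dv * ((d - 1) * ((d + 1) * d * p))) (y j) (hy j))).radical :=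
    fun l => KillCert.Lines.lines_hrad a b e₀ hd hprop (dv * (d - 1) * p) ((d + 1) * d * dv) (dv * ((d - 1) * ((d + 1) * d * p))) hE hdbarZ (fun j => coverElement 𝒜 (e₀.symm ∘ ![X 0, X 1, X 2]) ![d + 1, 1, 1] (dv * ((d - 1) * ((d + 1) * d * p))) (y j) (hy j))
      (by rw [coe_coverElement, hyval, hcov0]; congr 2; push_cast; ring) (fun i => by rw [coe_coverElement, hyval, hcovS i]) l
  have hH1 := Sym.symT_augmentationIdeal_sigmaR_le σ hC h0 h1 h2 d _ h3 e₀ τ₀ hact₀ ht hp.pos hσp₀ hσJ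
  have hmem0 := Sym.sym_u'_zero_mem_residual σ h1 d e₀ τ₀ hact₀ hp.pos hσp₀ hσJ
  have hdbarN : ∀ j : Fin (d + 1), (dv * ((d - 1) * ((d + 1) * d * p))) = (dv * (d - 1)) * ((d + 1) * d * p) := fun _ => hdeg.symm
  have hdn : 0 < d * (dv * (d - 1) * p) := Nat.mul_pos (by omega) hdp
  have hz0 := fun j => Sym.sym_residualSection_zero d e₀ (p := p) ![] 𝒜 hf (y j) (hy j) (dv * (d - 1)) (hdbarN j) _ hmem0 hdn
  have hsuppO : (((𝒦.ideal dv).support : Set X')) ⊆ (O.1 : Set (GModel.initial (p := p) (g₀ := g₀) hq h₀).V) := fun x _ => Set.mem_univ x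
  obtain ⟨OW, hOWaff, hOWeq, E, htame', hE', hpin, 𝔄₁, hF₁⟩ := exists_moveAtlas_of_node hp.pos hG (GModel.initial hq h₀) M₁
    (NodeAtlasData.ofNodeAtlas (p := p) (ρ := (⟨ρ, hq⟩ : ActionOver q G)) (g₀ := g₀) h₀) O hO
    ![] 𝒜 (e₀.symm ∘ ![X 0, X 1, X 2]) ![d + 1, 1, 1] hf τ₀ e' htame₀ hσp₀ hσ₀ hw hK1 hK1' hσJ 𝒦 dv hG𝒦 h𝒦tr hver hsuppO
    π₁ hbl hrM hcomm hk y hy hσy hrad (cobordantAlgebra.s (e₀.symm ∘ ![X 0, X 1, X 2]) ![d + 1, 1, 1] ^ d) hH1 (fun _ => 1)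
    (fun j => ![algebraMap _ (ChartRing 𝒜 (e₀.symm ∘ ![X 0, X 1, X 2]) ![d + 1, 1, 1] (dv * ((d - 1) * ((d + 1) * d * p))) (y j) (hy j)) (cobordantAlgebra.u' (e₀.symm ∘ ![X 0, X 1, X 2]) ![d + 1, 1, 1] 0 ^ (d * (dv * (d - 1) * p))) * IsLocalization.Away.invSelf (coverElement 𝒜 (e₀.symm ∘ ![X 0, X 1, X 2]) ![d + 1, 1, 1] (dv * ((d - 1) * ((d + 1) * d * p))) (y j) (hy j))])
    (fun j l => Fin.cases (hz0 j).1 (fun l' => l'.elim0) l) (fun j l => Fin.cases (hz0 j).2 (fun l' => l'.elim0) l)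
  have hWle : ∀ j, (OW j).1 ≤ π₁ ⁻¹ᵁ O.1 := fun j => by rw [hOWeq j]; exact blowupChart_le_preimage π₁ _ ⟨O.1, hO⟩ _
  -- ### chart 0 is killed
  have hc0 := Sym.sym_coverElement_zero_eq d e₀ (p := p) ![] 𝒜 (y 0) (hy 0) (dv * (d - 1)) (hdbarN 0) (by rw [hyval, hcov0])
  have hunit0 : algebraMap _ (ChartRing 𝒜 (e₀.symm ∘ ![X 0, X 1, X 2]) ![d + 1, 1, 1] (dv * ((d - 1) * ((d + 1) * d * p))) (y 0) (hy 0)) (cobordantAlgebra.u' (e₀.symm ∘ ![X 0, X 1, X 2]) ![d + 1, 1, 1] 0 ^ (d * (dv * (d - 1) * p))) * IsLocalization.Away.invSelf (coverElement 𝒜 (e₀.symm ∘ ![X 0, X 1, X 2]) ![d + 1, 1, 1] (dv * ((d - 1) * ((d + 1) * d * p))) (y 0) (hy 0)) = 1 := by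
    rw [← hc0]; exact IsLocalization.Away.mul_invSelf _
  have hz0W : ∀ v ∈ (OW 0).1, v ∈ M₁.V.basicOpen
      (letI := chartNodeGradedRing ![] 𝒜 (e₀.symm ∘ ![X 0, X 1, X 2]) ![d + 1, 1, 1] hf (dv * ((d - 1) * ((d + 1) * d * p))) (y 0) (hy 0); (E 0).symm ⟨_, (hz0 0).1⟩) := fun v hv => by
    letI := chartNodeGradedRing ![] 𝒜 (e₀.symm ∘ ![X 0, X 1, X 2]) ![d + 1, 1, 1] hf (dv * ((d - 1) * ((d + 1) * d * p))) (y 0) (hy 0)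
    have h1 : (⟨_, (hz0 0).1⟩ : ↥(chartNodeGrading ![] 𝒜 (e₀.symm ∘ ![X 0, X 1, X 2]) ![d + 1, 1, 1] hf (dv * ((d - 1) * ((d + 1) * d * p))) (y 0) (hy 0) 0)) = 1 := Subtype.ext hunit0
    rw [h1, map_one, Scheme.basicOpen_of_isUnit _ isUnit_one]
    exact hv
  have hF₁W : 𝔄₁.fLocus ⊆ ⋃ c : Fin d, (((OW c.succ)).1 : Set M₁.V) := by
    intro v hv
    rcases hF₁ hv with hold | hnew
    · exact absurd (Set.mem_univ _) hold.2
    · obtain ⟨j, hvW, hvR⟩ := Set.mem_iUnion.mp hnew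
      revert hvW hvR
      refine Fin.cases ?_ (fun i => ?_) j
      · intro hvW hvR; exact absurd (hz0W v hvW) (hvR 0)
      · intro hvW _; exact Set.mem_iUnion.mpr ⟨i, hvW⟩
  -- ### the charts cover `M₁`
  have hπ' : IsBlowup π₁ ((𝒦.ideal dv) ^ ((d - 1) * ((d + 1) * d * p))) := isBlowup_pow hbl hk.ne'
  have hverbar := CoarseChart.veroneseNormalised_mul 𝒜 _ _ hver hk
  have hJ' : ((𝒦.ideal dv) ^ ((d - 1) * ((d + 1) * d * p))).ideal ⟨O.1, hO⟩ =
      ((traceFiltration 𝒜 (e₀.symm ∘ ![X 0, X 1, X 2]) ![d + 1, 1, 1]).ideal (dv * ((d - 1) * ((d + 1) * d * p)))).comap (e' : Γ(X', O.1) →+* ↥(𝒜 0)) := by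
    rw [Scheme.IdealSheafData.ideal_pow, Pi.pow_apply, ← ReesFiltration.filtration_ideal, h𝒦tr dv, hver.2 ((d - 1) * ((d + 1) * d * p)), comap_equiv_pow]
  have hxJ : ∀ j, e'.symm (y j) ∈ ((𝒦.ideal dv) ^ ((d - 1) * ((d + 1) * d * p))).ideal ⟨O.1, hO⟩ := fun j => by
    rw [hJ', Ideal.mem_comap, RingHom.coe_coe, e'.apply_symm_apply]; exact hy j
  have hcovM : ∀ x : M₁.V, ∃ j, x ∈ (OW j).1 := by
    intro x
    have hcovW := iSup_blowupChart_eq_preimage (I := 𝒦.ideal dv) (GModel.initial hq h₀).act ![] 𝒜 (e₀.symm ∘ ![X 0, X 1, X 2]) ![d + 1, 1, 1] hf O hO e' hπ' hverbar hJ' y hy hrad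
    have hx : x ∈ ⨆ j, blowupChart π₁ ((𝒦.ideal dv) ^ ((d - 1) * ((d + 1) * d * p))) ⟨O.1, hO⟩ (e'.symm (y j)) :=
      (congrArg (fun U : M₁.V.Opens => x ∈ U) hcovW).mpr (Set.mem_univ _)
    obtain ⟨j, hj⟩ := Opens.mem_iSup.mp hx
    exact ⟨j, (congrArg (fun U : M₁.V.Opens => x ∈ U) (hOWeq j)).mpr hj⟩
  -- ### the transition sections
  have htrans : ∀ j j' : Fin (d + 1), letI := chartNodeGradedRing ![] 𝒜 (e₀.symm ∘ ![X 0, X 1, X 2]) ![d + 1, 1, 1] hf (dv * ((d - 1) * ((d + 1) * d * p))) (y j) (hy j)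
      ∃ t : Γ(M₁.V, (OW j).1),
        ((E j t : ↥(chartNodeGrading ![] 𝒜 (e₀.symm ∘ ![X 0, X 1, X 2]) ![d + 1, 1, 1] hf (dv * ((d - 1) * ((d + 1) * d * p))) (y j) (hy j) 0)) : (ChartRing 𝒜 (e₀.symm ∘ ![X 0, X 1, X 2]) ![d + 1, 1, 1] (dv * ((d - 1) * ((d + 1) * d * p))) (y j) (hy j))) = algebraMap _ (ChartRing 𝒜 (e₀.symm ∘ ![X 0, X 1, X 2]) ![d + 1, 1, 1] (dv * ((d - 1) * ((d + 1) * d * p))) (y j) (hy j)) (coverElement 𝒜 (e₀.symm ∘ ![X 0, X 1, X 2]) ![d + 1, 1, 1] (dv * ((d - 1) * ((d + 1) * d * p))) (y j') (hy j')) * IsLocalization.Away.invSelf (coverElement 𝒜 (e₀.symm ∘ ![X 0, X 1, X 2]) ![d + 1, 1, 1] (dv * ((d - 1) * ((d + 1) * d * p))) (y j) (hy j)) ∧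
        ∀ v ∈ (OW j).1, v ∈ (OW j').1 → v ∈ M₁.V.basicOpen t := by
    intro j j'
    letI := chartNodeGradedRing ![] 𝒜 (e₀.symm ∘ ![X 0, X 1, X 2]) ![d + 1, 1, 1] hf (dv * ((d - 1) * ((d + 1) * d * p))) (y j) (hy j)
    have hmem := transitionSection_mem_chartNodeGrading_zero ![] 𝒜 (e₀.symm ∘ ![X 0, X 1, X 2]) ![d + 1, 1, 1] hf (y j) (hy j) (y j') (hy j')
    have hpz : (E j).symm ⟨_, hmem⟩ * π₁.appLE O.1 (OW j).1 (hWle j) (e'.symm (y j)) = π₁.appLE O.1 (OW j).1 (hWle j) (e'.symm (y j')) :=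
      symm_mul_appLE_eq_of_pin π₁ O.1 (OW j).1 (hWle j) (chartNodeGrading ![] 𝒜 (e₀.symm ∘ ![X 0, X 1, X 2]) ![d + 1, 1, 1] hf (dv * ((d - 1) * ((d + 1) * d * p))) (y j) (hy j)) (E j) e'
        (toChartRing 𝒜 (e₀.symm ∘ ![X 0, X 1, X 2]) ![d + 1, 1, 1] (dv * ((d - 1) * ((d + 1) * d * p))) (y j) (hy j)) (hpin j (hWle j)) ⟨_, hmem⟩ (e'.symm (y j')) (e'.symm (y j)) (y j') (y j)
        (e'.apply_symm_apply _) (e'.apply_symm_apply _) (coverElement_section_pin ![] 𝒜 (e₀.symm ∘ ![X 0, X 1, X 2]) ![d + 1, 1, 1] (y j) (hy j) (y j') (hy j'))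
    refine ⟨(E j).symm ⟨_, hmem⟩, by rw [(E j).apply_symm_apply], fun v hvW hv' => ?_⟩
    exact mem_basicOpen_of_mem_blowupChart_of_mul_appLE_eq hπ' ⟨O.1, hO⟩ (hxJ j) (le_of_eq (hOWeq j)) _ hpz hvW
      ((congrArg (fun U : M₁.V.Opens => v ∈ U) (hOWeq j')).mp hv')
  choose tr htrE htrU using htrans
  -- ### the free model and the model values of the cover
  obtain ⟨Ψ, hΨa, hΨs, hΨ0, hΨ1, hΨ2⟩ := Sym.exists_symRootModel d e₀
  have hΨc0 : Ψ (coverElement 𝒜 (e₀.symm ∘ ![X 0, X 1, X 2]) ![d + 1, 1, 1] (dv * ((d - 1) * ((d + 1) * d * p))) (y 0) (hy 0)) = X (some 0) ^ (d * (dv * (d - 1) * p)) := by rw [hc0, map_pow, hΨ0]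
  have hΨcS : ∀ i : Fin d, Ψ (coverElement 𝒜 (e₀.symm ∘ ![X 0, X 1, X 2]) ![d + 1, 1, 1] (dv * ((d - 1) * ((d + 1) * d * p))) (y i.succ) (hy i.succ)) = (∏ m ∈ Finset.univ.erase i, ∏ j : ZMod p, ((C (a m) * X (some 1) + C (b m) * X (some 2)) + (j.val : MvPolynomial (Option (Fin 4)) k) * (C (a m + b m) * (X (some 0) * X none ^ d)))) ^ ((d + 1) * d * dv) := fun i =>
    KillCert.Lines.lines_model_coverElement_succ a b e₀ ![] 𝒜 (y i.succ) (hy i.succ) Ψ hΨa hΨs hΨ0 hΨ1 hΨ2 ((d + 1) * d * dv) hdbarZ i (by rw [hyval, hcovS i])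
  have hT' := KillCert.Lines.lines_subst_tail (k := k) a b
  have hdvd0 : (X (some 0) : MvPolynomial (Option (Fin 4)) k) ∣ Ψ (coverElement 𝒜 (e₀.symm ∘ ![X 0, X 1, X 2]) ![d + 1, 1, 1] (dv * ((d - 1) * ((d + 1) * d * p))) (y 0) (hy 0)) := by
    rw [hΨc0]; exact dvd_pow_self _ (Nat.mul_pos (by omega) hdp).ne'
  -- ### Veronese degrees of the members (common degree `∏ dV`)
  choose dV hdV using fun i : Fin d => exists_veroneseNormalised_symChartLin (p := p) d e₀ τ₀ hp.pos hσp₀ hσJ ![] 𝒜 hf hC0 (y i.succ) (hy i.succ) (hσy i.succ)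
    Ψ hΨa hΨ0 hΨ1 hΨ2 (htame' i.succ) (a i) (b i) ![if a i + b i = 0 then 1 else 2, 1]
  have hdVpos : ∀ i, 0 < dV i := fun i => (hdV i).1
  have hDpos : 0 < ∏ i, dV i := Finset.prod_pos fun i _ => hdVpos i
  -- ### model facts of the members: the unit `H_i = ∏_{m≠i} ℓ_m` divides `Ψ(c_{i+1})`, the point, the other charts
  have hdvdS : ∀ i : Fin d, (∏ m ∈ Finset.univ.erase i, (C (a m) * X (some 1) + C (b m) * X (some 2) : MvPolynomial (Option (Fin 4)) k)) ∣
      Ψ (coverElement 𝒜 (e₀.symm ∘ ![X 0, X 1, X 2]) ![d + 1, 1, 1] (dv * ((d - 1) * ((d + 1) * d * p))) (y i.succ) (hy i.succ)) := fun i => by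
    rw [hΨcS i]; exact KillCert.Lines.lines_model_dvd_self a b _ hE.ne' i
  have huS : ∀ i : Fin d, MvPolynomial.eval (fun o => if o = some 1 then b i else if o = some 2 then -a i else 0) (Ψ (coverElement 𝒜 (e₀.symm ∘ ![X 0, X 1, X 2]) ![d + 1, 1, 1] (dv * ((d - 1) * ((d + 1) * d * p))) (y i.succ) (hy i.succ))) ≠ 0 := fun i => by
    rw [hΨcS i]; exact KillCert.Lines.lines_model_eval_ne_zero a b hprop _ i
  have hdvdO : ∀ i m : Fin d, m ≠ i → (C (a i) * X (some 1) + C (b i) * X (some 2) : MvPolynomial (Option (Fin 4)) k) ∣ Ψ (coverElement 𝒜 (e₀.symm ∘ ![X 0, X 1, X 2]) ![d + 1, 1, 1] (dv * ((d - 1) * ((d + 1) * d * p))) (y m.succ) (hy m.succ)) := fun i m hm => by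
    rw [hΨcS m]; exact KillCert.Lines.lines_model_dvd_other a b _ hE.ne' i m (Ne.symm hm)
  have hne01 : ¬ (some 0 : Option (Fin 4)) = some 1 := by decide
  have hne02 : ¬ (some 0 : Option (Fin 4)) = some 2 := by decide
  have hne21 : ¬ (some 2 : Option (Fin 4)) = some 1 := by decide
  have hg0 : ∀ i : Fin d, (fun o : Option (Fin 4) => if o = some 1 then b i else if o = some 2 then -a i else 0) (some 0) = 0 := fun i => by
    show (if (some 0 : Option (Fin 4)) = some 1 then b i else if (some 0 : Option (Fin 4)) = some 2 then -a i else 0) = 0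
    rw [if_neg hne01, if_neg hne02]
  have hgL : ∀ i : Fin d, a i * (fun o : Option (Fin 4) => if o = some 1 then b i else if o = some 2 then -a i else 0) (some 1) +
      b i * (fun o : Option (Fin 4) => if o = some 1 then b i else if o = some 2 then -a i else 0) (some 2) = 0 := fun i => by
    show a i * (if (some 1 : Option (Fin 4)) = some 1 then b i else if (some 1 : Option (Fin 4)) = some 2 then -a i else 0) +
      b i * (if (some 2 : Option (Fin 4)) = some 1 then b i else if (some 2 : Option (Fin 4)) = some 2 then -a i else 0) = 0
    rw [if_pos rfl, if_neg hne21, if_pos rfl]; ring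
  -- ### the `d` members
  have hmem : ∀ i : Fin d, ∃ J : ReesFiltration M₁.V, IsPrincipalCentre p M₁.act g₀ J (∏ m, dV m) ∧ IsPrincipalCentreChart p M₁.act g₀ J (∏ m, dV m) (OW i.succ) ∧
      (((J.ideal (∏ m, dV m)).support : Set M₁.V)) ⊆ ((OW i.succ).1 : Set M₁.V) ∧
      ∀ j : {j : Fin (d + 1) // j ≠ i.succ}, Disjoint (((OW j.1).1 : Set M₁.V)) (((J.ideal (∏ m, dV m)).support : Set M₁.V)) := by
    intro i
    have hl : 0 < ∏ m ∈ Finset.univ.erase i, dV m := Finset.prod_pos fun m _ => hdVpos m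
    obtain ⟨J, hJ, hJW, hJsupp, hJoff⟩ := exists_isPrincipalCentre_of_symChartLine hG σ hC h0 h1 h2 d _ h3 e₀ τ₀ hact₀ ht hp.pos hσp₀ hσJ ![] 𝒜 hf hC0
      (y i.succ) (hy i.succ) (hσy i.succ) Ψ hΨa hΨs hΨ0 hΨ1 hΨ2 (∏ m : Fin d, (C (a m) * X (some 1) + C (b m) * X (some 2) : MvPolynomial (Option (Fin 4)) k)) hT' M₁ (OW i.succ) (hOWaff i.succ) (E i.succ) (htame' i.succ) (hE' i.succ)
      (a i) (b i) (KillCert.Lines.lines_ab_ne_zero a b hd hprop i)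
      (∏ m ∈ Finset.univ.erase i, (C (a m) * X (some 1) + C (b m) * X (some 2) : MvPolynomial (Option (Fin 4)) k)) (KillCert.Lines.lines_prod_erase_mul a b i)
      (hdvdS i) (fun o => if o = some 1 then b i else if o = some 2 then -a i else 0) (hg0 i) (hgL i) (huS i)
      (dV i) (∏ m ∈ Finset.univ.erase i, dV m) hl (hdV i)
      (fun j : {j : Fin (d + 1) // j ≠ i.succ} => (OW j.1).1)
      (fun x => by
        obtain ⟨j, hj⟩ := hcovM x
        by_cases hji : j = i.succ
        · exact Or.inl (hji ▸ hj)
        · exact Or.inr ⟨⟨j, hji⟩, hj⟩)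
      (fun j => tr i.succ j.1) (fun j => coverElement 𝒜 (e₀.symm ∘ ![X 0, X 1, X 2]) ![d + 1, 1, 1] (dv * ((d - 1) * ((d + 1) * d * p))) (y j.1) (hy j.1)) (fun j => htrE i.succ j.1)
      (fun j => by
        obtain ⟨j, hj⟩ := j
        revert hj
        refine Fin.cases (fun _ => Or.inl hdvd0) (fun m hm => Or.inr (hdvdO i m fun h => hm (by rw [h]))) j)
      (fun j => htrU i.succ j.1)
    rw [Finset.mul_prod_erase _ _ (Finset.mem_univ i)] at hJ hJW hJsupp hJoff
    exact ⟨J, hJ, hJW, hJsupp, hJoff⟩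
  choose J hJ hJW hJsupp hJoff using hmem
  -- ### MOVE 2: the parallel kill of the `d` components
  refine killsIn_one_of_disjointPrincipalFamily_datum hp hG φ M₁ 𝔄₁ J hDpos hJ ?_ id (fun c => OW c.succ) hJW ?_ hF₁W
  · intro i m him
    exact (hJoff m ⟨i.succ, fun h => him (Fin.succ_injective _ h)⟩).mono_left (hJsupp i)
  · intro c m hm
    exact hJoff m ⟨c.succ, fun h => hm (Fin.succ_injective _ h).symm⟩

/-- ★★★ **R3 OF RECORD: the line-arrangement class `L_d` inhabits the research stub** — for every node atlas `𝔄₀` on the initial model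
the conclusion of `ReachLowerInF(X)` holds at `(M₀, 𝔄₀)` (✓`exists_reachLowerF_of_killsIn_datum` on `lines_killsIn_two`).
[OURS · L1 W4.5c · R-F15l; NOT a statement of the manuscript] -/
theorem exists_reachLowerF_initial_of_lines [Finite G] (hp : p.Prime) (hG : ∀ g : G, g ∈ Subgroup.zpowers g₀) (hg₀ : g₀ ^ p = 1)
    (hq : ∀ g : G, (ρ g).hom ≫ q = q) [IsIntegral X'] [IsLocallyNoetherian X'] [X'.IsSeparated] [IsAffine X']
    (hreg : Scheme.IsRegular X') {k' : Type} [Field k'] (φ : X₁ ⟶ Spec (.of k')) [IsSeparated φ] [LocallyOfFiniteType φ] [IsFinite q]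
    {k : Type} [Field k] [CharP k p] (σ : MvPolynomial (Fin 4) k ≃+* MvPolynomial (Fin 4) k) (hC : ∀ a : k, σ (C a) = C a)
    (h0 : σ (X 0) = X 0) (h1 : σ (X 1) = X 1 + X 0) (h2 : σ (X 2) = X 2 + X 0)
    {d : ℕ} (hd : 2 ≤ d) (a b : Fin d → k) (hprop : ∀ i j : Fin d, i ≠ j → a i * b j ≠ a j * b i)
    (h3 : σ (X 3) = X 3 + (∏ m : Fin d, (C (a m) * X 1 + C (b m) * X 2)))
    (e : Γ(X', ⊤) ≃+* MvPolynomial (Fin 4) k)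
    (hστ : ∀ t : Γ(X', ⊤), e ((ρ g₀⁻¹).hom.appLE ⊤ ⊤ (by rw [Scheme.Hom.preimage_top]) t) = σ (e t))
    (h₀ : NodeAtlas p (⟨ρ, hq⟩ : ActionOver q G) g₀) (𝔄₀ : NodeAtlasData p (GModel.initial hq h₀).act g₀) :
    ∃ P : ∀ M : GModel p q G ρ g₀, NodeAtlasData p M.act g₀ → Prop,
      P (GModel.initial hq h₀) 𝔄₀ ∧ ∀ (M : GModel p q G ρ g₀) (𝔄 : NodeAtlasData p M.act g₀), P M 𝔄 → ¬ M.Terminal →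
        ∃ n : ℕ, TreeF P (fun N 𝔅 => LexLTF N 𝔅 M 𝔄) n M 𝔄 :=
  exists_reachLowerF_of_killsIn_datum hp hG φ (GModel.initial hq h₀) 𝔄₀ (lines_killsIn_two hp hG hg₀ hq hreg φ σ hC h0 h1 h2 hd a b hprop h3 e hστ h₀)

end Summit.ResolutionOfSingularities.ResolutionOfSingularities.Theorems.WildQuotientResolution.S1.GameFrame.GModel

end
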